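import Literature.AlgebraicGeometry.Resolution.Blowups
import Literature.AlgebraicGeometry.Resolution.MarkedIdealsLemmas
import HarnessLib

/-!
# [OURS · L1 W4.5(b)] Blow-ups along idempotent ideal sheaves are open immersions (general schemes; proofs only)

Cell res-hironaka (LADDER-RESOLUTION rung L, D-0089), slot W4.5(b), crux EL♮ (stmt-ResolutionOfSingularities-20038);
`--supports … --as helper`. Prover res-type-100 (gen 9). The MECHANISM behind the negative side of
`EquisingularLift.SpecialFibreReduciblePersists` (custody res-plan-2 2026-08-27T05:33:15Z «(1⁻) := res-type-100»), stated for
arbitrary schemes over the tree's blow-up library (`Literature/AlgebraicGeometry/Resolution/Blowups.lean`).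

For a scheme `X` and a quasi-coherent ideal sheaf `I` (Mathlib `Scheme.IdealSheafData`) all of whose local ideals
`I(U)` (`U` affine) are IDEMPOTENT, `I(U)² = I(U)`:

* `comap_eq_top_of_isEffectiveCartier_of_isIdempotentElem` — a morphism `f : W → X` pulls `I` back to an effective
  Cartier divisor (`IsEffectiveCartier (I.comap f)`, `Blowups.lean`) only if `f⁻¹ I · 𝒪_W` is the unit ideal: locally
  `f⁻¹I·𝒪_W = (g)` with `g` regular (GW I (13.19)) and `(g) = (g)²` (chart formula `ideal_comap_of_le`,
  `MarkedIdealsLemmas.lean`), so `g = a g²`, `(1 - a g) g = 0`, `g` is a unit;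
* `isBlowup_ι_compl_support_of_isIdempotentElem` — hence the open immersion `X ∖ Supp I ↪ X` IS a blow-up of `X`
  along `I` in the sense of the universal property (`IsBlowup`, Görtz–Wedhorn I Def. 13.90): every such `f` misses
  `Supp I` and factors uniquely through the open immersion. In particular a blow-up in the universal-property sense
  need not be surjective, nor proper, when the centre is not of finite type (for `I` of finite type and `X` integral,
  idempotence forces `I(U) ∈ {0, (1)}` locally by Nakayama, and the statement is void).

Used by `…/EquisingularLiftCampaignW45bULTSpecialFibrePersistsCounterexample.lean` (the blow-up of `Spec O[y^{q ≥ 0}, ϖy⁻¹]`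
along `(y^q : q > 0)`). Elementary consequence of the definitions; no named fact is used or introduced; nothing here is a
statement of H. Hironaka's manuscript. AI-written; AI review is weaker than expert review. [Hironaka2017] — scope only.

References: U. Görtz, T. Wedhorn, *Algebraic Geometry I*, 2nd ed. (2020), Def. 13.90 and Prop. 13.91 [GortzWedhorn2020];
The Stacks Project, Tag 01OF (blowing up), Tag 02OS [StacksProject].
-/

noncomputable section

set_option linter.dupNamespace false -- mandated namespace of this single-conjunct summit

open CategoryTheory AlgebraicGeometry TopologicalSpace Topology
open Literature.AlgebraicGeometry.Resolution

namespace Summit.ResolutionOfSingularities.ResolutionOfSingularities.Theorems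

namespace EquisingularLift

universe u

/-! ## Blow-ups along idempotent ideal sheaves are open immersions -/

/-- If every local ideal `I(U)` of the ideal sheaf `I` is idempotent (`I(U)² = I(U)`), then a morphism `f : W → X` pulls
`I` back to an effective Cartier divisor only if it pulls it back to the unit ideal sheaf: locally `f⁻¹I·𝒪_W = (g)` with
`g` regular and `(g) = (g)²`, so `g` is a unit. [folklore] -/
theorem comap_eq_top_of_isEffectiveCartier_of_isIdempotentElem {X : Scheme.{u}} {I : X.IdealSheafData}
    (hI : ∀ U : X.affineOpens, IsIdempotentElem (I.ideal U)) {W : Scheme.{u}} (f : W ⟶ X)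
    (hf : IsEffectiveCartier (I.comap f)) : I.comap f = ⊤ := by
  rw [← Scheme.IdealSheafData.support_eq_bot_iff, eq_bot_iff]
  intro w hw
  exfalso
  obtain ⟨V, hwV, g, hg, hgV⟩ := hf w
  obtain ⟨Ua, hUa, hfwUa, -⟩ :=
    exists_isAffineOpen_mem_and_subset (X := X) (x := f w) (U := ⊤) (Opens.mem_top _)
  obtain ⟨V'o, hV', hwV', hV'sub⟩ :=
    exists_isAffineOpen_mem_and_subset (X := W) (x := w) (U := (V : W.Opens) ⊓ f ⁻¹ᵁ Ua) ⟨hwV, hfwUa⟩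
  let V' : W.affineOpens := ⟨V'o, hV'⟩
  have hV'V : (V' : W.Opens) ≤ V := fun x hx => (hV'sub hx).1
  have hV'U : (V' : W.Opens) ≤ f ⁻¹ᵁ Ua := fun x hx => (hV'sub hx).2
  -- the generator restricted to `V'`
  let g' : Γ(W, V') := W.presheaf.map (homOfLE hV'V).op g
  have hg' : g' ∈ nonZeroDivisors Γ(W, V') := map_mem_nonZeroDivisors_of_le hV'V hg
  have h1 : (I.comap f).ideal V' = Ideal.span {g'} := by
    rw [← (I.comap f).map_ideal hV'V, hgV, Ideal.map_span, Set.image_singleton]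
    rfl
  -- `(I.comap f)(V') = I(Ua) · Γ(W, V')` is idempotent
  have h2 : (I.comap f).ideal V' * (I.comap f).ideal V' = (I.comap f).ideal V' := by
    rw [ideal_comap_of_le f I ⟨Ua, hUa⟩ V' hV'U, ← Ideal.map_mul, (hI ⟨Ua, hUa⟩).eq]
  -- hence `g'` is a unit
  have h3 : IsUnit g' := by
    rw [h1, Ideal.span_singleton_mul_span_singleton] at h2
    have hmem : g' ∈ Ideal.span {g' * g'} := h2 ▸ Ideal.mem_span_singleton_self g'
    obtain ⟨c, hc⟩ := Ideal.mem_span_singleton.mp hmem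
    have h0 : (1 - g' * c) * g' = 0 := by
      rw [sub_mul, one_mul, sub_eq_zero]
      calc g' = g' * g' * c := hc
        _ = g' * c * g' := by ring
    have h1' : 1 - g' * c = 0 := (mem_nonZeroDivisors_iff_right.mp hg') _ h0
    exact IsUnit.of_mul_eq_one c (sub_eq_zero.mp h1').symm
  have h4 : (I.comap f).ideal V' = ⊤ := by rw [h1, Ideal.span_singleton_eq_top]; exact h3
  -- but `w ∈ Supp (I.comap f) ∩ V'`
  have h5 := (Scheme.IdealSheafData.mem_support_iff_of_mem (I := I.comap f) (U := V') hwV').mp hw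
  rw [h4] at h5
  have h6 := (W.mem_zeroLocus_iff _ w).mp h5 1 Submodule.mem_top
  rw [Scheme.basicOpen_of_isUnit _ isUnit_one] at h6
  exact h6 hwV'

/-- **A blow-up along an idempotent ideal sheaf is the open immersion of the complement of its support.** If every
`I(U)` is idempotent, the open immersion `X ∖ Supp I ↪ X` is a blow-up of `X` along `I` in the sense of the universal
property (tree `Resolution.IsBlowup`, Görtz–Wedhorn I Def. 13.90): the pulled-back ideal is the unit ideal (an effective
Cartier divisor), and every `f : W → X` pulling `I` back to an effective Cartier divisor misses `Supp I`
(`comap_eq_top_of_isEffectiveCartier_of_isIdempotentElem`), hence factors uniquely through the open immersion. In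
particular such a blow-up is NOT surjective as soon as `Supp I ≠ ∅` — possible only for ideal sheaves that are not of
finite type on the relevant opens (Nakayama). [folklore] -/
theorem isBlowup_ι_compl_support_of_isIdempotentElem {X : Scheme.{u}} {I : X.IdealSheafData}
    (hI : ∀ U : X.affineOpens, IsIdempotentElem (I.ideal U)) :
    IsBlowup (X := X) (Scheme.Opens.ι ⟨(I.support : Set X)ᶜ, I.support.isClosed.isOpen_compl⟩) I := by
  set U : X.Opens := ⟨(I.support : Set X)ᶜ, I.support.isClosed.isOpen_compl⟩ with hU
  have hIU : I.comap U.ι = ⊤ := by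
    rw [← Scheme.IdealSheafData.support_eq_bot_iff, Scheme.IdealSheafData.support_comap]
    ext x
    simp only [Closeds.coe_preimage, Set.mem_preimage, Closeds.coe_bot, Set.mem_empty_iff_false, iff_false]
    intro hx
    exact x.2 hx
  refine ⟨by rw [hIU]; exact isEffectiveCartier_top, fun W f hf => ?_⟩
  have htop := comap_eq_top_of_isEffectiveCartier_of_isIdempotentElem hI f hf
  have hrange : Set.range f ⊆ Set.range U.ι := by
    rintro _ ⟨w, rfl⟩
    rw [Scheme.Opens.range_ι]
    intro hmem
    have : w ∈ ((I.comap f).support : Set W) := by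
      rw [Scheme.IdealSheafData.support_comap]; exact hmem
    rw [htop, Scheme.IdealSheafData.support_top] at this
    exact this
  refine ⟨IsOpenImmersion.lift U.ι f hrange, IsOpenImmersion.lift_fac _ _ _, fun g hg => ?_⟩
  rw [← cancel_mono U.ι, IsOpenImmersion.lift_fac]
  exact hg

end EquisingularLift

end Summit.ResolutionOfSingularities.ResolutionOfSingularities.Theorems

end
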